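import Summits.QuantumFields.BalabanUV.T4Continuum.Support.RegionElectricGeneral

/-!
# T⁴ programme, spine node NE2 (U1a), sub-row Δ1 «NE2⁰-Dirichlet» — THE EXTERIOR FLUX OF A STAR-BOND FIELD ON AN ARBITRARY UNION OF
# BLOCKS, TWO-SIDED: `n²·Σ_y bdW [nbrCount ≤ 1] y·‖A y‖² ≤ extFlux A ≤ n²·Σ_y bdW nbrCount y·‖A y‖²`, with `nbrCount x ≤ d` at `2 ≤ n`

NE2 formalisation swarm `b2b-balaban-t4-ne2-formalise-*`, LEAF PROVER 02 (gen 9), support item «Δ1-CORNER-COUPLING», file 1 of 2 (file 2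
`Support/RegionCornerCoupling`: the sharp form and norm bounds of gen 8's corner coupling `cornerC`).  The located successor estimate of this
lineage (gen 8's file 6 `Support/RegionElectricGeneral` p240775: «on a general union `C` is supported on the star bonds attached to exterior
sites with two or more attached bonds … its norm `≍ n²` on that set is the successor's estimate»; row-NE2 owner ruling R37 (e) (i), journal
2026-08-20 l.22730: «`Δ_loc` is NO LONGER COMPONENTWISE — the exterior-flux block `E·Eᴴ` couples the two normal star bonds of different components
at every re-entrant exterior site») rests on ONE quantity: the exterior flux `extFlux A = Σ_{x ∉ Ω} ‖(∂ᴴιA)(x)‖²` of gen 6's lattice Gaffney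
identity (`RegionGaffneyIdentity.gaffney_region`: `‖curlR A‖² + ‖gradRᴴA‖² + extFlux A = Σ_ν ‖∇_ν ιA‖²`).  Under H1 it is EXACTLY the
own-direction charge (gen 8's `extFlux_eq`); THIS FILE bounds it on EVERY union of blocks, from both sides, by star-bond masses weighted at the
exterior endpoints:

 * §1 **`nbrCount x`** — the number of lattice neighbours of a site inside `Ω` —; `AtMostOneNeighbour ↔ ∀ x ∉ Ω, nbrCount x ≤ 1`
   (`atMostOneNeighbour_iff`); at `2 ≤ n` an exterior site is never entered from both signs of one direction (`not_nbr_both`, gen 7's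
   `not_both_exits`), hence **`nbrCount_le : 2 ≤ n → x ∉ Ω → nbrCount x ≤ d`**.
 * §2 the exterior divergence at `x ∉ Ω` as the sum of the `2d` signed contributions `divTerm` of the attached bonds (non-zero only for an
   `Ω`-neighbour, `mem_nbrIn_of_divTerm_ne_zero`); Cauchy–Schwarz ON THE SUPPORT (`norm_sum_sq_le_card_mul`) gives **`divS_ext_sq_le_nbrCount`**
   `‖(∂ᴴιA)(x)‖² ≤ nbrCount x·n²·Σ_μ (‖ιA(x − e_μ, μ)‖² + ‖ιA(x, μ)‖²)`, with EQUALITY when `nbrCount x ≤ 1` (`divS_ext_sq_eq_of_nbrCount_le_one`).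
 * §3 the boundary weight **`bdW g b = [head ∉ Ω]·g(head) + [tail ∉ Ω]·g(tail)`** of a bond with a site density `g` (monotone and linear in `g`
   on the exterior) and the weighted charge transport `Σ_{x ∉ Ω} g(x)·Σ_μ (‖ιA(x − e_μ, μ)‖² + ‖ιA(x, μ)‖²) = Σ_{y star} bdW g y·‖A y‖²`
   (`sum_weight_eq_bdW`); §4 THE ENDS **`extFlux_le_nbrCount`** and **`extFlux_ge_isolated`** (title), for every decidable `S` and every `n`.

HONEST FRAMING (T4-DAG p. 1).  Lattice bookkeeping at MODEL level (`U = 1`, ONE region, finite torus); statements OURS ([folklore]); no estimate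
on any tower, no W2, no Hessian budget on re-entrant regions is claimed; W3 on boxes OPEN; Δ1 NOT closed; NE2 (U1a) NOT proved; spine PROVED 0/9
unchanged; NOT [B9] (3.16)/(3.23)–(3.27) as printed; NOT infinite volume, NOT a mass gap, NOT the Clay problem.  HONEST DEPENDENCY: continuum YM
on T⁴ ⇐ BetaPertH ∧ nine spine estimates (0/9 proved); BetaPertH ⇐ (D1) ∧ (D4) ∧ CAP+tail; G-an2-4 gates asym, D1 and NE2/3/4.  No `sorry`.
-/

noncomputable section

open scoped BigOperators ComplexConjugate Matrix Matrix.Norms.L2Operator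
open Finset

namespace Summit.QuantumFields.BalabanUV.T4Continuum.RegionExteriorFlux

open Literature.MathematicalPhysics.QuantumFieldTheory.Balaban1983to89.B5Prop11Plancherel (Tor fine unitVec)
open Literature.MathematicalPhysics.QuantumFieldTheory.Balaban1983to89.B5Prop11Lower (nsq nsq_nonneg)
open Literature.MathematicalPhysics.QuantumFieldTheory.Balaban1983to89.B5Action121 (GradOp divS divS_apply GradOp_conjTranspose_mulVec_eq)
open Summit.QuantumFields.BalabanUV.T4Continuum
open Summit.QuantumFields.BalabanUV.T4Continuum.SubtypeCompression (ext ext_apply_of ext_apply_of_not)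
open Summit.QuantumFields.BalabanUV.T4Continuum.RegionGaugeFixedVector (starReg)
open Summit.QuantumFields.BalabanUV.T4Continuum.RegionGaffneyIdentity (extFlux)
open Summit.QuantumFields.BalabanUV.T4Continuum.RegionStarBoundaryCharges (nbr AtMostOneNeighbour not_both_exits)
open Summit.QuantumFields.BalabanUV.Beta.GAN24.DirichletBoxTrace (blockReg)

variable {d : ℕ}

/-! ## §0 Cauchy–Schwarz on the support -/

/-- Cauchy–Schwarz ON THE SUPPORT: if every non-zero term has its index in `T`, then `‖Σ w‖² ≤ #T·Σ ‖w‖²`. [folklore] -/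
theorem norm_sum_sq_le_card_mul {ι : Type*} [Fintype ι] [DecidableEq ι] (w : ι → ℂ) (T : Finset ι) (h : ∀ i, w i ≠ 0 → i ∈ T) :
    ‖∑ i, w i‖ ^ 2 ≤ (T.card : ℝ) * ∑ i, ‖w i‖ ^ 2 := by
  have h0 : ∀ i ∈ (univ : Finset ι), i ∉ T → w i = 0 := fun i _ hi => by
    by_contra hne
    exact hi (h i hne)
  have hsum : ∑ i, w i = ∑ i ∈ T, w i := (sum_subset (subset_univ T) h0).symm
  have h1 : ‖∑ i ∈ T, w i‖ ≤ ∑ i ∈ T, ‖w i‖ := norm_sum_le _ _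
  have h2 : (∑ i ∈ T, ‖w i‖) ^ 2 ≤ (T.card : ℝ) * ∑ i ∈ T, ‖w i‖ ^ 2 := sq_sum_le_card_mul_sum_sq
  have h3 : ∑ i ∈ T, ‖w i‖ ^ 2 ≤ ∑ i, ‖w i‖ ^ 2 :=
    sum_le_sum_of_subset_of_nonneg (subset_univ T) fun i _ _ => sq_nonneg _
  calc ‖∑ i, w i‖ ^ 2 = ‖∑ i ∈ T, w i‖ ^ 2 := by rw [hsum]
    _ ≤ (∑ i ∈ T, ‖w i‖) ^ 2 := pow_le_pow_left₀ (norm_nonneg _) h1 2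
    _ ≤ (T.card : ℝ) * ∑ i ∈ T, ‖w i‖ ^ 2 := h2
    _ ≤ (T.card : ℝ) * ∑ i, ‖w i‖ ^ 2 := mul_le_mul_of_nonneg_left h3 (Nat.cast_nonneg _)

section Region

variable (n : ℕ) [NeZero n] (M : Fin d → ℕ) [hM : ∀ μ, NeZero (M μ)] (S : Tor M → Prop) [DecidablePred S]

/-! ## §1 The number of `Ω`-neighbours of a site -/

/-- the lattice neighbours of `x` lying in `Ω`, indexed by (direction, sign). [folklore] -/
def nbrIn (x : Tor (fine n M)) : Finset (Fin d × Bool) := univ.filter fun i => blockReg n M S (nbr n M x i)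

/-- **THE NUMBER OF `Ω`-NEIGHBOURS** of a site. [folklore] -/
def nbrCount (x : Tor (fine n M)) : ℕ := (nbrIn n M S x).card

/-- membership in `nbrIn`. [folklore] -/
theorem mem_nbrIn {x : Tor (fine n M)} {i : Fin d × Bool} : i ∈ nbrIn n M S x ↔ blockReg n M S (nbr n M x i) := by
  simp [nbrIn]

/-- a site has at most `2d` neighbours in `Ω`. [folklore] -/
theorem nbrCount_le_two_mul (x : Tor (fine n M)) : nbrCount n M S x ≤ 2 * d := by
  unfold nbrCount nbrIn
  calc (univ.filter fun i => blockReg n M S (nbr n M x i)).card ≤ (univ : Finset (Fin d × Bool)).card := card_filter_le _ _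
    _ = 2 * d := by rw [card_univ, Fintype.card_prod, Fintype.card_fin, Fintype.card_bool, mul_comm]

/-- **H1 ⟺ every exterior site has at most one `Ω`-neighbour.** [folklore] -/
theorem atMostOneNeighbour_iff : AtMostOneNeighbour n M S ↔ ∀ x, ¬ blockReg n M S x → nbrCount n M S x ≤ 1 := by
  unfold AtMostOneNeighbour nbrCount
  refine forall₂_congr fun x _ => ?_
  rw [Finset.card_le_one]
  simp only [mem_nbrIn]
  exact ⟨fun h a ha b hb => h a b ha hb, fun h i j hi hj => h i hi j hj⟩

omit [DecidablePred S] in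
/-- at `2 ≤ n` an exterior site is NOT entered from both signs of one direction (the exterior is a union of blocks of side `≥ 2`).
[folklore] -/
theorem not_nbr_both (hn : 2 ≤ n) {x : Tor (fine n M)} (hx : ¬ blockReg n M S x) (μ : Fin d)
    (h1 : blockReg n M S (x + unitVec (fine n M) μ)) (h2 : blockReg n M S (x - unitVec (fine n M) μ)) : False := by
  unfold blockReg at hx h1 h2
  exact not_both_exits n M hn x μ (fun e => hx (e ▸ h1)) (fun e => hx (e ▸ h2))

/-- **hence at `2 ≤ n` an exterior site has at most `d` neighbours in `Ω`** (at most one per direction). [folklore] -/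
theorem nbrCount_le (hn : 2 ≤ n) {x : Tor (fine n M)} (hx : ¬ blockReg n M S x) : nbrCount n M S x ≤ d := by
  unfold nbrCount
  have hinj : Set.InjOn Prod.fst (nbrIn n M S x : Set (Fin d × Bool)) := by
    rintro ⟨μ, s⟩ hi ⟨μ', t⟩ hj hij
    rw [mem_coe, mem_nbrIn] at hi hj
    simp only at hij
    subst hij
    cases s <;> cases t
    · rfl
    · exact (not_nbr_both n M S hn hx μ (by simpa [nbr] using hj) (by simpa [nbr] using hi)).elim
    · exact (not_nbr_both n M S hn hx μ (by simpa [nbr] using hi) (by simpa [nbr] using hj)).elim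
    · rfl
  calc (nbrIn n M S x).card ≤ (univ : Finset (Fin d)).card := card_le_card_of_injOn Prod.fst (fun i _ => mem_univ _) hinj
    _ = d := by rw [card_univ, Fintype.card_fin]

/-! ## §2 The exterior divergence at a site: its `2d` contributions, Cauchy–Schwarz on the support -/

/-- the signed contribution of the bond attached to `x` via (direction, sign) to the exterior divergence `(∂ᴴιA)(x)`. [folklore] -/
def divTerm (A : {b // starReg n M S b} → ℂ) (x : Tor (fine n M)) (i : Fin d × Bool) : ℂ :=
  if i.2 then -((n : ℂ) * ext (starReg n M S) A (x, i.1)) else (n : ℂ) * ext (starReg n M S) A (x - unitVec (fine n M) i.1, i.1)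

/-- `(∂ᴴιA)(x) = Σ_i divTerm i`. [folklore] -/
theorem divS_ext_eq_sum (A : {b // starReg n M S b} → ℂ) (x : Tor (fine n M)) :
    divS (fine n M) (n : ℂ) (ext (starReg n M S) A) x = ∑ i, divTerm n M S A x i := by
  rw [divS_apply, Fintype.sum_prod_type]
  refine sum_congr rfl fun μ _ => ?_
  rw [Fintype.sum_bool]
  simp only [divTerm, if_true, Bool.false_eq_true, if_false, Complex.conj_natCast]
  ring

/-- a non-zero contribution at an exterior site comes from a neighbour INSIDE `Ω`. [folklore] -/
theorem mem_nbrIn_of_divTerm_ne_zero (A : {b // starReg n M S b} → ℂ) {x : Tor (fine n M)} (hx : ¬ blockReg n M S x)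
    {i : Fin d × Bool} (hi : divTerm n M S A x i ≠ 0) : i ∈ nbrIn n M S x := by
  rw [mem_nbrIn]
  obtain ⟨μ, b⟩ := i
  cases b
  · simp only [divTerm, Bool.false_eq_true, if_false] at hi
    have h' : ext (starReg n M S) A (x - unitVec (fine n M) μ, μ) ≠ 0 := fun h0 => hi (by rw [h0, mul_zero])
    have hs : starReg n M S (x - unitVec (fine n M) μ, μ) := by
      by_contra hs; exact h' (ext_apply_of_not _ _ hs)
    rcases hs with h1 | h2
    · simpa [nbr] using h1
    · simp only [sub_add_cancel] at h2; exact absurd h2 hx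
  · simp only [divTerm, if_true] at hi
    have h' : ext (starReg n M S) A (x, μ) ≠ 0 := fun h0 => hi (by rw [h0, mul_zero, neg_zero])
    have hs : starReg n M S (x, μ) := by
      by_contra hs; exact h' (ext_apply_of_not _ _ hs)
    rcases hs with h1 | h2
    · exact absurd h1 hx
    · simpa [nbr] using h2

/-- the squared contributions: `Σ_i ‖divTerm i‖² = n²·Σ_μ (‖ιA(x − e_μ, μ)‖² + ‖ιA(x, μ)‖²)`. [folklore] -/
theorem sum_norm_divTerm_sq (A : {b // starReg n M S b} → ℂ) (x : Tor (fine n M)) :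
    ∑ i, ‖divTerm n M S A x i‖ ^ 2
      = (n : ℝ) ^ 2 * ∑ μ, (‖ext (starReg n M S) A (x - unitVec (fine n M) μ, μ)‖ ^ 2 + ‖ext (starReg n M S) A (x, μ)‖ ^ 2) := by
  rw [Fintype.sum_prod_type, mul_sum]
  refine sum_congr rfl fun μ _ => ?_
  rw [Fintype.sum_bool]
  simp only [divTerm, if_true, Bool.false_eq_true, if_false, norm_neg, norm_mul, Complex.norm_natCast, mul_pow]
  ring

/-- **THE LOCAL DIVERGENCE BOUND** (any region, any exterior site): `‖(∂ᴴιA)(x)‖² ≤ nbrCount x·n²·Σ_μ (‖ιA(x − e_μ, μ)‖² + ‖ιA(x, μ)‖²)`.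
[folklore] -/
theorem divS_ext_sq_le_nbrCount (A : {b // starReg n M S b} → ℂ) {x : Tor (fine n M)} (hx : ¬ blockReg n M S x) :
    ‖divS (fine n M) (n : ℂ) (ext (starReg n M S) A) x‖ ^ 2
      ≤ (nbrCount n M S x : ℝ) * ((n : ℝ) ^ 2
          * ∑ μ, (‖ext (starReg n M S) A (x - unitVec (fine n M) μ, μ)‖ ^ 2 + ‖ext (starReg n M S) A (x, μ)‖ ^ 2)) := by
  rw [divS_ext_eq_sum, ← sum_norm_divTerm_sq]
  exact norm_sum_sq_le_card_mul _ _ fun i hi => mem_nbrIn_of_divTerm_ne_zero n M S A hx hi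

/-- … WITH EQUALITY when `x` has at most one `Ω`-neighbour (the flux there is fed by one bond). [folklore] -/
theorem divS_ext_sq_eq_of_nbrCount_le_one (A : {b // starReg n M S b} → ℂ) {x : Tor (fine n M)} (hx : ¬ blockReg n M S x)
    (h1 : nbrCount n M S x ≤ 1) :
    ‖divS (fine n M) (n : ℂ) (ext (starReg n M S) A) x‖ ^ 2
      = (n : ℝ) ^ 2 * ∑ μ, (‖ext (starReg n M S) A (x - unitVec (fine n M) μ, μ)‖ ^ 2 + ‖ext (starReg n M S) A (x, μ)‖ ^ 2) := by
  rw [divS_ext_eq_sum, ← sum_norm_divTerm_sq]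
  set w := divTerm n M S A x with hw
  -- at most one contribution is non-zero
  have hpair : ∀ i j, i ≠ j → w i = 0 ∨ w j = 0 := by
    intro i j hij
    by_contra hc
    rw [not_or] at hc
    exact hij (Finset.card_le_one.mp h1 i (mem_nbrIn_of_divTerm_ne_zero n M S A hx hc.1) j
      (mem_nbrIn_of_divTerm_ne_zero n M S A hx hc.2))
  -- so `‖Σ w‖² = Σ ‖w‖²` (the equality form of gen 7's `norm_sum_sq_le_of_pairwise`, as in gen 8's `divS_ext_sq_eq`)
  by_cases hex : ∃ i, w i ≠ 0
  · obtain ⟨i₀, hi₀⟩ := hex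
    have hz : ∀ j ∈ (univ : Finset (Fin d × Bool)), j ≠ i₀ → w j = 0 := fun j _ hj => (hpair j i₀ hj).resolve_right hi₀
    rw [sum_eq_single i₀ hz (fun hh => absurd (mem_univ _) hh),
      sum_eq_single i₀ (fun j hj hne => by rw [hz j hj hne, norm_zero, zero_pow two_ne_zero]) (fun hh => absurd (mem_univ _) hh)]
  · push Not at hex
    simp [hex]

/-! ## §3 The boundary weight of a bond; weighted charge transport -/

/-- **THE BOUNDARY WEIGHT** of a bond with site density `g`: `[head ∉ Ω]·g(head) + [tail ∉ Ω]·g(tail)`. [folklore] -/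
def bdW (g : Tor (fine n M) → ℝ) (b : Tor (fine n M) × Fin d) : ℝ :=
  (if blockReg n M S (b.1 + unitVec (fine n M) b.2) then 0 else g (b.1 + unitVec (fine n M) b.2))
    + (if blockReg n M S b.1 then 0 else g b.1)

/-- `bdW` is monotone in the density on the exterior. [folklore] -/
theorem bdW_mono {g₁ g₂ : Tor (fine n M) → ℝ} (h : ∀ x, ¬ blockReg n M S x → g₁ x ≤ g₂ x) (b : Tor (fine n M) × Fin d) :
    bdW n M S g₁ b ≤ bdW n M S g₂ b := by
  unfold bdW
  refine add_le_add ?_ ?_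
  · split_ifs with hh
    · exact le_rfl
    · exact h _ hh
  · split_ifs with hh
    · exact le_rfl
    · exact h _ hh

/-- `bdW` only reads the density on the exterior. [folklore] -/
theorem bdW_congr {g₁ g₂ : Tor (fine n M) → ℝ} (h : ∀ x, ¬ blockReg n M S x → g₁ x = g₂ x) (b : Tor (fine n M) × Fin d) :
    bdW n M S g₁ b = bdW n M S g₂ b :=
  le_antisymm (bdW_mono n M S (fun x hx => (h x hx).le) b) (bdW_mono n M S (fun x hx => (h x hx).ge) b)

/-- `bdW` is linear in the density: differences. [folklore] -/
theorem bdW_sub (g₁ g₂ : Tor (fine n M) → ℝ) (b : Tor (fine n M) × Fin d) :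
    bdW n M S g₁ b - bdW n M S g₂ b = bdW n M S (fun x => g₁ x - g₂ x) b := by
  unfold bdW
  split_ifs <;> ring

/-- `bdW` is linear in the density: scalars. [folklore] -/
theorem mul_bdW (c : ℝ) (g : Tor (fine n M) → ℝ) (b : Tor (fine n M) × Fin d) :
    c * bdW n M S g b = bdW n M S (fun x => c * g x) b := by
  unfold bdW
  split_ifs <;> ring

/-- a nonnegative density gives a nonnegative weight. [folklore] -/
theorem bdW_nonneg {g : Tor (fine n M) → ℝ} (h : ∀ x, ¬ blockReg n M S x → 0 ≤ g x) (b : Tor (fine n M) × Fin d) :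
    0 ≤ bdW n M S g b := by
  have := bdW_mono n M S (g₁ := fun _ => 0) (g₂ := g) h b
  have h0 : bdW n M S (fun _ => (0 : ℝ)) b = 0 := by unfold bdW; split_ifs <;> ring
  linarith

omit [DecidablePred S] in
/-- a STAR bond has at most one exterior endpoint, so a density `≤ 1` gives a weight `≤ 1` there. [folklore] -/
theorem bdW_le_one_of_star [DecidablePred S] {g : Tor (fine n M) → ℝ} (h : ∀ x, ¬ blockReg n M S x → g x ≤ 1)
    (y : {b // starReg n M S b}) : bdW n M S g y.1 ≤ 1 := by
  obtain ⟨⟨x, ν⟩, hy⟩ := y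
  unfold bdW
  rcases hy with hx | hz
  · simp only
    rw [if_pos (show blockReg n M S x from hx), add_zero]
    split_ifs with hh
    · exact zero_le_one
    · exact h _ hh
  · simp only
    rw [if_pos (show blockReg n M S (x + unitVec (fine n M) ν) from hz), zero_add]
    split_ifs with hh
    · exact zero_le_one
    · exact h _ hh

/-- the head charges with density `g` live on the star bonds: `Σ_{x ∉ Ω} g(x)·Σ_μ ‖ιA(x − e_μ, μ)‖² = Σ_y [head ∉ Ω]·g(head)·‖A y‖²`. [folklore] -/
theorem sum_head_weight_eq (g : Tor (fine n M) → ℝ) (A : {b // starReg n M S b} → ℂ) :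
    ∑ x : {x // ¬ blockReg n M S x}, g x.1 * ∑ μ, ‖ext (starReg n M S) A (x.1 - unitVec (fine n M) μ, μ)‖ ^ 2
      = ∑ y : {b // starReg n M S b},
          (if blockReg n M S (y.1.1 + unitVec (fine n M) y.1.2) then (0 : ℝ)
            else g (y.1.1 + unitVec (fine n M) y.1.2) * ‖A y‖ ^ 2) := by
  set F : Tor (fine n M) → ℝ := fun x =>
    if blockReg n M S x then 0 else g x * ∑ μ, ‖ext (starReg n M S) A (x - unitVec (fine n M) μ, μ)‖ ^ 2 with hF
  have h1 : ∑ x : {x // ¬ blockReg n M S x}, g x.1 * ∑ μ, ‖ext (starReg n M S) A (x.1 - unitVec (fine n M) μ, μ)‖ ^ 2 = ∑ x, F x := by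
    rw [← Fintype.sum_subtype_add_sum_subtype (blockReg n M S) F]
    have h0 : ∑ x : {x // blockReg n M S x}, F x = 0 := sum_eq_zero fun x _ => by simp only [hF, x.2, if_true]
    rw [h0, zero_add]
    exact sum_congr rfl fun x _ => by simp only [hF, x.2, if_false]
  set G : Tor (fine n M) × Fin d → ℝ := fun c =>
    if blockReg n M S (c.1 + unitVec (fine n M) c.2) then 0
      else g (c.1 + unitVec (fine n M) c.2) * ‖ext (starReg n M S) A c‖ ^ 2 with hG
  have h2 : ∑ x, F x = ∑ c, G c := by
    have e1 : ∑ x, F x = ∑ μ : Fin d, ∑ x : Tor (fine n M),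
        (if blockReg n M S x then (0 : ℝ) else g x * ‖ext (starReg n M S) A (x - unitVec (fine n M) μ, μ)‖ ^ 2) := by
      rw [sum_comm]
      refine sum_congr rfl fun x _ => ?_
      simp only [hF]
      split_ifs
      · simp
      · rw [mul_sum]
    rw [e1, Fintype.sum_prod_type_right]
    refine sum_congr rfl fun μ _ => ?_
    refine Fintype.sum_equiv (Equiv.subRight (unitVec (fine n M) μ)) _ _ fun x => ?_
    simp only [hG, Equiv.subRight_apply, sub_add_cancel]
  have h3 : ∑ c, G c = ∑ y : {b // starReg n M S b},
      (if blockReg n M S (y.1.1 + unitVec (fine n M) y.1.2) then (0 : ℝ)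
        else g (y.1.1 + unitVec (fine n M) y.1.2) * ‖A y‖ ^ 2) := by
    rw [← Fintype.sum_subtype_add_sum_subtype (starReg n M S) G]
    have h0 : ∑ z : {b // ¬ starReg n M S b}, G z = 0 := sum_eq_zero fun z _ => by
      simp only [hG]
      split_ifs
      · rfl
      · rw [ext_apply_of_not _ _ z.2, norm_zero, zero_pow two_ne_zero, mul_zero]
    rw [h0, add_zero]
    refine sum_congr rfl fun y _ => ?_
    simp only [hG]
    split_ifs
    · rfl
    · rw [ext_apply_of]
  rw [h1, h2, h3]

/-- the tail charges with density `g` live on the star bonds: `Σ_{x ∉ Ω} g(x)·Σ_μ ‖ιA(x, μ)‖² = Σ_y [tail ∉ Ω]·g(tail)·‖A y‖²`. [folklore] -/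
theorem sum_tail_weight_eq (g : Tor (fine n M) → ℝ) (A : {b // starReg n M S b} → ℂ) :
    ∑ x : {x // ¬ blockReg n M S x}, g x.1 * ∑ μ, ‖ext (starReg n M S) A (x.1, μ)‖ ^ 2
      = ∑ y : {b // starReg n M S b}, (if blockReg n M S y.1.1 then (0 : ℝ) else g y.1.1 * ‖A y‖ ^ 2) := by
  set F : Tor (fine n M) → ℝ := fun x => if blockReg n M S x then 0 else g x * ∑ μ, ‖ext (starReg n M S) A (x, μ)‖ ^ 2 with hF
  have h1 : ∑ x : {x // ¬ blockReg n M S x}, g x.1 * ∑ μ, ‖ext (starReg n M S) A (x.1, μ)‖ ^ 2 = ∑ x, F x := by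
    rw [← Fintype.sum_subtype_add_sum_subtype (blockReg n M S) F]
    have h0 : ∑ x : {x // blockReg n M S x}, F x = 0 := sum_eq_zero fun x _ => by simp only [hF, x.2, if_true]
    rw [h0, zero_add]
    exact sum_congr rfl fun x _ => by simp only [hF, x.2, if_false]
  set G : Tor (fine n M) × Fin d → ℝ := fun c => if blockReg n M S c.1 then 0 else g c.1 * ‖ext (starReg n M S) A c‖ ^ 2 with hG
  have h2 : ∑ x, F x = ∑ c, G c := by
    rw [Fintype.sum_prod_type]
    refine sum_congr rfl fun x _ => ?_
    simp only [hF, hG]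
    split_ifs
    · simp
    · rw [mul_sum]
  have h3 : ∑ c, G c = ∑ y : {b // starReg n M S b}, (if blockReg n M S y.1.1 then (0 : ℝ) else g y.1.1 * ‖A y‖ ^ 2) := by
    rw [← Fintype.sum_subtype_add_sum_subtype (starReg n M S) G]
    have h0 : ∑ z : {b // ¬ starReg n M S b}, G z = 0 := sum_eq_zero fun z _ => by
      simp only [hG]
      split_ifs
      · rfl
      · rw [ext_apply_of_not _ _ z.2, norm_zero, zero_pow two_ne_zero, mul_zero]
    rw [h0, add_zero]
    refine sum_congr rfl fun y _ => ?_
    simp only [hG]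
    split_ifs
    · rfl
    · rw [ext_apply_of]
  rw [h1, h2, h3]

/-- **THE WEIGHTED CHARGE TRANSPORT**: `Σ_{x ∉ Ω} g(x)·Σ_μ (‖ιA(x − e_μ, μ)‖² + ‖ιA(x, μ)‖²) = Σ_{y star} bdW g y·‖A y‖²`. [folklore] -/
theorem sum_weight_eq_bdW (g : Tor (fine n M) → ℝ) (A : {b // starReg n M S b} → ℂ) :
    ∑ x : {x // ¬ blockReg n M S x}, g x.1
        * ∑ μ, (‖ext (starReg n M S) A (x.1 - unitVec (fine n M) μ, μ)‖ ^ 2 + ‖ext (starReg n M S) A (x.1, μ)‖ ^ 2)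
      = ∑ y : {b // starReg n M S b}, bdW n M S g y.1 * ‖A y‖ ^ 2 := by
  have e : ∀ x : {x // ¬ blockReg n M S x},
      g x.1 * ∑ μ, (‖ext (starReg n M S) A (x.1 - unitVec (fine n M) μ, μ)‖ ^ 2 + ‖ext (starReg n M S) A (x.1, μ)‖ ^ 2)
        = g x.1 * ∑ μ, ‖ext (starReg n M S) A (x.1 - unitVec (fine n M) μ, μ)‖ ^ 2
          + g x.1 * ∑ μ, ‖ext (starReg n M S) A (x.1, μ)‖ ^ 2 := fun x => by
    rw [sum_add_distrib, mul_add]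
  rw [sum_congr rfl fun x _ => e x, sum_add_distrib, sum_head_weight_eq, sum_tail_weight_eq, ← sum_add_distrib]
  refine sum_congr rfl fun y _ => ?_
  unfold bdW
  split_ifs <;> ring

/-! ## §4 The ENDs: two-sided exterior-flux bounds on any region -/

/-- the exterior flux as a sum of local divergences. [folklore] -/
theorem extFlux_eq_sum_divS (A : {b // starReg n M S b} → ℂ) :
    extFlux n M S A = ∑ x : {x // ¬ blockReg n M S x}, ‖divS (fine n M) (n : ℂ) (ext (starReg n M S) A) x.1‖ ^ 2 := by
  unfold extFlux
  rw [GradOp_conjTranspose_mulVec_eq]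

/-- **UPPER FLUX BOUND** (any region, any `n`): `extFlux A ≤ n²·Σ_y bdW nbrCount y·‖A y‖²` — each exterior endpoint of a star bond weighted by
its number of `Ω`-neighbours (`≤ d` at `2 ≤ n`, `nbrCount_le`). [folklore] -/
theorem extFlux_le_nbrCount (A : {b // starReg n M S b} → ℂ) :
    extFlux n M S A ≤ (n : ℝ) ^ 2 * ∑ y : {b // starReg n M S b}, bdW n M S (fun x => (nbrCount n M S x : ℝ)) y.1 * ‖A y‖ ^ 2 := by
  rw [extFlux_eq_sum_divS, ← sum_weight_eq_bdW, mul_sum]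
  refine sum_le_sum fun x _ => ?_
  rw [mul_left_comm]
  exact divS_ext_sq_le_nbrCount n M S A x.2

/-- **LOWER FLUX BOUND** (any region, any `n`): `n²·Σ_y bdW [nbrCount ≤ 1] y·‖A y‖² ≤ extFlux A` — the exterior sites with at most one
`Ω`-neighbour feed the flux exactly. [folklore] -/
theorem extFlux_ge_isolated (A : {b // starReg n M S b} → ℂ) :
    (n : ℝ) ^ 2 * ∑ y : {b // starReg n M S b}, bdW n M S (fun x => if nbrCount n M S x ≤ 1 then (1 : ℝ) else 0) y.1 * ‖A y‖ ^ 2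
      ≤ extFlux n M S A := by
  rw [extFlux_eq_sum_divS, ← sum_weight_eq_bdW, mul_sum]
  refine sum_le_sum fun x _ => ?_
  split_ifs with h1
  · rw [one_mul, divS_ext_sq_eq_of_nbrCount_le_one n M S A x.2 h1]
  · rw [zero_mul, mul_zero]; exact sq_nonneg _

/-- under H1 the upper density `nbrCount` is dominated by the lower one `[nbrCount ≤ 1]` on the exterior, so the two flux bounds coincide there
(consistency with gen 8's `extFlux_eq`). [folklore] -/
theorem bdW_nbrCount_le_isolated_of_atMostOne (hH : AtMostOneNeighbour n M S) (b : Tor (fine n M) × Fin d) :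
    bdW n M S (fun x => (nbrCount n M S x : ℝ)) b ≤ bdW n M S (fun x => if nbrCount n M S x ≤ 1 then (1 : ℝ) else 0) b := by
  rw [atMostOneNeighbour_iff] at hH
  refine bdW_mono n M S (fun x hx => ?_) b
  have h1 := hH x hx
  rw [if_pos h1]
  exact_mod_cast h1

end Region

end Summit.QuantumFields.BalabanUV.T4Continuum.RegionExteriorFlux

end
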